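import Summits.AtomisticToContinuum.BoseEinsteinCondensation.Theses.BECMeanFieldControl
import Literature.MathematicalPhysics.QuantumManyBody.PeriodicBoseGasFracEnergy
import Literature.MathematicalPhysics.QuantumManyBody.SwapPurity
import Mathlib
import HarnessLib

/-!
# Route `BECMeanFieldControl` — support item `LandscapeToCondensate` (stmt-AtomisticToContinuum-8703)

The route decl `LandscapeToCondensate`, proved as stated (the one-sided Penrose–Onsager step on the
torus): for `L > 0`, `C ∈ ℝ` and a NONNEGATIVE periodic trial state `Ψ` of `n + 1` bosons
(hypothesis `Ψ X = ‖Ψ X‖`), if the exceptional mass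
`∫_{cell^n} ∫_cell |Ψ(x,Y)|² · vol{y ∈ cell : |Ψ(y,Y)| < e^{-C} |Ψ(x,Y)|} dx dY ≤ L³/2`
then `condensateOccupation (n+1) L Ψ ≥ (n+1) e^{-C} / 2`.

Proof. `occ₀ = (n+1) L⁻³ ∫ s(Y)² dY` with `s(Y) = ∫_cell Ψ(·,Y)` (`condensateOccupation_succ`; for
`Ψ ≥ 0` the modulus of the slice integral is the lower integral of `|Ψ|`,
`enorm_setIntegral_slice`). Pointwise in `Y` (`exp_mul_lintegral_sq_mul_good_le`),
`s² = ∫_x |Ψ(x,Y)| s ≥ ∫_x |Ψ(x,Y)| ∫_{good(x,Y)} e^{-C}|Ψ(x,Y)| = e^{-C} ∫_x |Ψ(x,Y)|² vol(good(x,Y))`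
with `good(x,Y) = {y ∈ cell : e^{-C}|Ψ(x,Y)| ≤ |Ψ(y,Y)|}`. Since `cell ⊆ good ∪ bad`,
`L³ = L³ ∫_{cell^{n+1}} |Ψ|² ≤ G + B` where `G`, `B` are the `|Ψ|²`-weighted good/bad volumes
integrated over `cell^{n+1} ≅ cell × cell^n` (`lintegral_cellN_succ`, `norm_eq`); `B ≤ L³/2` by
hypothesis, so `G ≥ L³/2` (`half_volume_le_goodMass`) and `occ₀ ≥ (n+1) L⁻³ e^{-C} L³/2`.

Ingredients: `condensateOccupation_succ`, `lintegral_cellN_succ`, `integrableOn_cell`,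
`measurable_vecCons`, `measurable_vecTail` (Literature, periodic Bose gas / swap purity files);
Mathlib's `measurable_measure_prodMk_left`, `setLIntegral_mono`, `lintegral_mul_const`,
`lintegral_add_left`, `Complex.nnnorm_real`, `ofReal_integral_norm_eq_lintegral_enorm`.
No named facts are used (unconditional). Sources of the argument: Penrose–Onsager 1956 (the
`⟨φ₀, γφ₀⟩` criterion), LSSY2005 §1.2.
-/

noncomputable section

open MeasureTheory Set Filter
open scoped ENNReal NNReal ComplexConjugate

namespace Summit.AtomisticToContinuum.BoseEinsteinCondensation.Theorems

open Literature.MathematicalPhysics.QuantumManyBody.BoseGas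
open Summit.AtomisticToContinuum.BoseEinsteinCondensation.Theses.BECMeanFieldControl

namespace LandscapeToCondensate

variable {n : ℕ} {L : ℝ}

/-- The slice `x ↦ Ψ(x, Y)` of a continuous `Ψ` is continuous. [folklore] -/
theorem continuous_slice {Ψ : Config (n + 1) → ℂ} (hΨ : Continuous Ψ) (Y : Config n) :
    Continuous fun x : Space => Ψ (Matrix.vecCons x Y) :=
  hΨ.comp (continuous_id.matrixVecCons continuous_const)

/-- For a nonnegative continuous `Ψ`, the modulus of the cell average of a slice is the lower
integral of the modulus: `‖∫_cell Ψ(x,Y) dx‖ = ∫⁻_cell ‖Ψ(x,Y)‖ dx`. [folklore] -/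
theorem enorm_setIntegral_slice {Ψ : Config (n + 1) → ℂ} (hΨc : Continuous Ψ)
    (hΨ : ∀ X, Ψ X = (‖Ψ X‖ : ℂ)) (Y : Config n) :
    (‖∫ x in cell L, Ψ (Matrix.vecCons x Y)‖₊ : ℝ≥0∞) =
      ∫⁻ x in cell L, (‖Ψ (Matrix.vecCons x Y)‖₊ : ℝ≥0∞) := by
  have h1 : ∫ x in cell L, Ψ (Matrix.vecCons x Y) =
      ((∫ x in cell L, ‖Ψ (Matrix.vecCons x Y)‖ : ℝ) : ℂ) := by
    rw [← integral_complex_ofReal]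
    exact integral_congr_ae (Eventually.of_forall fun x => hΨ _)
  rw [h1, Complex.nnnorm_real, ← enorm_eq_nnnorm, ← ofReal_norm,
    Real.norm_of_nonneg (integral_nonneg fun _ => norm_nonneg _),
    ofReal_integral_norm_eq_lintegral_enorm (integrableOn_cell (continuous_slice hΨc Y))]
  rfl

/-- **The one-sided, Jensen-free step**, pointwise in the spectator variables `Y`: with
`s = ∫⁻_cell ‖Ψ(·,Y)‖` and `good(x) = {y ∈ cell : e^{-C}‖Ψ(x,Y)‖ ≤ ‖Ψ(y,Y)‖}`,
`e^{-C} ∫⁻_cell ‖Ψ(x,Y)‖² vol(good(x)) dx ≤ s²`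
(`s² = ∫_x ‖Ψ(x,Y)‖ s`, `s ≥ ∫_{good(x)} ‖Ψ(·,Y)‖ ≥ e^{-C}‖Ψ(x,Y)‖ vol(good(x))`). [folklore] -/
theorem exp_mul_lintegral_sq_mul_good_le {Ψ : Config (n + 1) → ℂ} (hΨc : Continuous Ψ)
    (C : ℝ) (Y : Config n) :
    ENNReal.ofReal (Real.exp (-C)) *
        ∫⁻ x in cell L, (‖Ψ (Matrix.vecCons x Y)‖₊ : ℝ≥0∞) ^ 2 *
          volume {y : Space | y ∈ cell L ∧
            Real.exp (-C) * ‖Ψ (Matrix.vecCons x Y)‖ ≤ ‖Ψ (Matrix.vecCons y Y)‖} ≤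
      (∫⁻ x in cell L, (‖Ψ (Matrix.vecCons x Y)‖₊ : ℝ≥0∞)) ^ 2 := by
  obtain ⟨f, hf⟩ : ∃ f : Space → ℝ≥0∞, f = fun x => (‖Ψ (Matrix.vecCons x Y)‖₊ : ℝ≥0∞) :=
    ⟨_, rfl⟩
  have hfm : Measurable f := by
    rw [hf]
    exact (continuous_slice hΨc Y).measurable.nnnorm.coe_nnreal_ennreal
  have hfx : ∀ x, (‖Ψ (Matrix.vecCons x Y)‖₊ : ℝ≥0∞) = f x := fun x => by rw [hf]
  simp only [hfx]
  set E : ℝ≥0∞ := ENNReal.ofReal (Real.exp (-C)) with hE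
  set s : ℝ≥0∞ := ∫⁻ x in cell L, f x with hs
  -- the pointwise bound `E f(x)² vol(good(x)) ≤ f(x) s`
  have hpt : ∀ x : Space,
      E * (f x ^ 2 * volume {y : Space | y ∈ cell L ∧
        Real.exp (-C) * ‖Ψ (Matrix.vecCons x Y)‖ ≤ ‖Ψ (Matrix.vecCons y Y)‖}) ≤ f x * s := by
    intro x
    set G : Set Space := {y : Space | y ∈ cell L ∧
        Real.exp (-C) * ‖Ψ (Matrix.vecCons x Y)‖ ≤ ‖Ψ (Matrix.vecCons y Y)‖} with hG
    have hGsub : G ⊆ cell L := fun y hy => hy.1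
    have hconst : ∀ y ∈ G, E * f x ≤ f y := by
      intro y hy
      rw [hE, ← hfx, ← hfx, ← enorm_eq_nnnorm, ← enorm_eq_nnnorm, ← ofReal_norm,
        ← ofReal_norm, ← ENNReal.ofReal_mul (Real.exp_pos _).le]
      exact ENNReal.ofReal_le_ofReal hy.2
    calc E * (f x ^ 2 * volume G)
        = f x * (E * f x * volume G) := by ring
      _ = f x * ∫⁻ _ in G, E * f x := by rw [setLIntegral_const]
      _ ≤ f x * ∫⁻ y in G, f y := mul_le_mul_right (setLIntegral_mono hfm hconst) _
      _ ≤ f x * s := mul_le_mul_right (lintegral_mono_set hGsub) _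
  calc E * ∫⁻ x in cell L, f x ^ 2 * volume {y : Space | y ∈ cell L ∧
          Real.exp (-C) * ‖Ψ (Matrix.vecCons x Y)‖ ≤ ‖Ψ (Matrix.vecCons y Y)‖}
      = ∫⁻ x in cell L, E * (f x ^ 2 * volume {y : Space | y ∈ cell L ∧
          Real.exp (-C) * ‖Ψ (Matrix.vecCons x Y)‖ ≤ ‖Ψ (Matrix.vecCons y Y)‖}) :=
        (lintegral_const_mul' E _ ENNReal.ofReal_ne_top).symm
    _ ≤ ∫⁻ x in cell L, f x * s := lintegral_mono hpt
    _ = s * s := lintegral_mul_const s hfm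
    _ = s ^ 2 := (sq s).symm

/-- Measurability of the `|Ψ|²`-weighted good volume
`X ↦ ‖Ψ X‖² · vol{y ∈ cell : e^{-C}‖Ψ X‖ ≤ ‖Ψ(y, tail X)‖}` (sections of a measurable subset of
`(ℝ³)^{n+1} × ℝ³`, `measurable_measure_prodMk_left`). [folklore] -/
theorem measurable_sq_mul_volume_good {Ψ : Config (n + 1) → ℂ} (hΨc : Continuous Ψ) (C L : ℝ) :
    Measurable fun X : Config (n + 1) => (‖Ψ X‖₊ : ℝ≥0∞) ^ 2 *
      volume {y : Space | y ∈ cell L ∧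
        Real.exp (-C) * ‖Ψ X‖ ≤ ‖Ψ (Matrix.vecCons y (Matrix.vecTail X))‖} := by
  have hΨm : Measurable Ψ := hΨc.measurable
  have h1 : Measurable fun p : Config (n + 1) × Space => Real.exp (-C) * ‖Ψ p.1‖ :=
    (hΨm.comp measurable_fst).norm.const_mul _
  have h2 : Measurable fun p : Config (n + 1) × Space =>
      ‖Ψ (Matrix.vecCons p.2 (Matrix.vecTail p.1))‖ :=
    (hΨm.comp (measurable_vecCons.comp
      (measurable_snd.prodMk (measurable_vecTail.comp measurable_fst)))).norm
  have hS : MeasurableSet {p : Config (n + 1) × Space | p.2 ∈ cell L ∧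
      Real.exp (-C) * ‖Ψ p.1‖ ≤ ‖Ψ (Matrix.vecCons p.2 (Matrix.vecTail p.1))‖} :=
    ((measurableSet_cell L).preimage measurable_snd).inter (measurableSet_le h1 h2)
  exact (hΨm.nnnorm.coe_nnreal_ennreal.pow_const 2).mul (measurable_measure_prodMk_left hS)

/-- Measurability of the `|Ψ|²`-weighted bad (exceptional) volume
`X ↦ ‖Ψ X‖² · vol{y ∈ cell : ‖Ψ(y, tail X)‖ < e^{-C}‖Ψ X‖}`. [folklore] -/
theorem measurable_sq_mul_volume_bad {Ψ : Config (n + 1) → ℂ} (hΨc : Continuous Ψ) (C L : ℝ) :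
    Measurable fun X : Config (n + 1) => (‖Ψ X‖₊ : ℝ≥0∞) ^ 2 *
      volume {y : Space | y ∈ cell L ∧
        ‖Ψ (Matrix.vecCons y (Matrix.vecTail X))‖ < Real.exp (-C) * ‖Ψ X‖} := by
  have hΨm : Measurable Ψ := hΨc.measurable
  have h1 : Measurable fun p : Config (n + 1) × Space => Real.exp (-C) * ‖Ψ p.1‖ :=
    (hΨm.comp measurable_fst).norm.const_mul _
  have h2 : Measurable fun p : Config (n + 1) × Space =>
      ‖Ψ (Matrix.vecCons p.2 (Matrix.vecTail p.1))‖ :=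
    (hΨm.comp (measurable_vecCons.comp
      (measurable_snd.prodMk (measurable_vecTail.comp measurable_fst)))).norm
  have hS : MeasurableSet {p : Config (n + 1) × Space | p.2 ∈ cell L ∧
      ‖Ψ (Matrix.vecCons p.2 (Matrix.vecTail p.1))‖ < Real.exp (-C) * ‖Ψ p.1‖} :=
    ((measurableSet_cell L).preimage measurable_snd).inter (measurableSet_lt h2 h1)
  exact (hΨm.nnnorm.coe_nnreal_ennreal.pow_const 2).mul (measurable_measure_prodMk_left hS)

/-- **Mass splitting.** For a periodic trial state `Ψ` of `n + 1` bosons whose exceptional mass is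
`≤ L³/2`, the good mass is `≥ L³/2`:
`L³/2 ≤ ∫_{cell^n}∫_cell |Ψ(x,Y)|² vol{y ∈ cell : e^{-C}|Ψ(x,Y)| ≤ |Ψ(y,Y)|} dx dY`
(`cell ⊆ good ∪ bad`, `∫_{cell^{n+1}} |Ψ|² = 1` and Tonelli `cell^{n+1} ≅ cell × cell^n`). [folklore] -/
theorem half_volume_le_goodMass (hL : 0 < L) (C : ℝ) (Ψ : PeriodicTrialState (n + 1) L)
    (hbad : ∫⁻ Y in cellN n L, ∫⁻ x in cell L, (‖Ψ.ψ (Matrix.vecCons x Y)‖₊ : ℝ≥0∞) ^ 2 *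
        volume {y : Space | y ∈ cell L ∧
          ‖Ψ.ψ (Matrix.vecCons y Y)‖ < Real.exp (-C) * ‖Ψ.ψ (Matrix.vecCons x Y)‖} ≤
      ENNReal.ofReal (L ^ 3 / 2)) :
    ENNReal.ofReal (L ^ 3 / 2) ≤
      ∫⁻ Y in cellN n L, ∫⁻ x in cell L, (‖Ψ.ψ (Matrix.vecCons x Y)‖₊ : ℝ≥0∞) ^ 2 *
        volume {y : Space | y ∈ cell L ∧
          Real.exp (-C) * ‖Ψ.ψ (Matrix.vecCons x Y)‖ ≤ ‖Ψ.ψ (Matrix.vecCons y Y)‖} := by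
  have hΨc : Continuous Ψ.ψ := Ψ.contDiff.continuous
  have hΨm : Measurable Ψ.ψ := hΨc.measurable
  -- the weighted good / bad volumes as functions on `cell^{n+1}`
  obtain ⟨Fg, hFg⟩ : ∃ Fg : Config (n + 1) → ℝ≥0∞, Fg = fun X => (‖Ψ.ψ X‖₊ : ℝ≥0∞) ^ 2 *
      volume {y : Space | y ∈ cell L ∧
        Real.exp (-C) * ‖Ψ.ψ X‖ ≤ ‖Ψ.ψ (Matrix.vecCons y (Matrix.vecTail X))‖} := ⟨_, rfl⟩
  obtain ⟨Fb, hFb⟩ : ∃ Fb : Config (n + 1) → ℝ≥0∞, Fb = fun X => (‖Ψ.ψ X‖₊ : ℝ≥0∞) ^ 2 *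
      volume {y : Space | y ∈ cell L ∧
        ‖Ψ.ψ (Matrix.vecCons y (Matrix.vecTail X))‖ < Real.exp (-C) * ‖Ψ.ψ X‖} := ⟨_, rfl⟩
  have hFgm : Measurable Fg := hFg ▸ measurable_sq_mul_volume_good hΨc C L
  have hFbm : Measurable Fb := hFb ▸ measurable_sq_mul_volume_bad hΨc C L
  -- Tonelli: the bad mass is the hypothesis, the good mass is the claim
  have hB : ∫⁻ X in cellN (n + 1) L, Fb X ≤ ENNReal.ofReal (L ^ 3 / 2) := by
    rw [lintegral_cellN_succ L hFbm]
    simpa only [hFb, Matrix.tail_cons] using hbad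
  have hG : ∫⁻ X in cellN (n + 1) L, Fg X =
      ∫⁻ Y in cellN n L, ∫⁻ x in cell L, (‖Ψ.ψ (Matrix.vecCons x Y)‖₊ : ℝ≥0∞) ^ 2 *
        volume {y : Space | y ∈ cell L ∧
          Real.exp (-C) * ‖Ψ.ψ (Matrix.vecCons x Y)‖ ≤ ‖Ψ.ψ (Matrix.vecCons y Y)‖} := by
    rw [lintegral_cellN_succ L hFgm]
    simp only [hFg, Matrix.tail_cons]
  -- total mass: `L³ = ∫ |Ψ|² L³ ≤ ∫ Fg + ∫ Fb`
  have hpt : ∀ X, (‖Ψ.ψ X‖₊ : ℝ≥0∞) ^ 2 * ENNReal.ofReal L ^ 3 ≤ Fg X + Fb X := by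
    intro X
    rw [hFg, hFb]
    dsimp only
    rw [← mul_add, ← volume_cell L]
    refine mul_le_mul_right ((measure_mono ?_).trans (measure_union_le _ _)) _
    intro y hy
    by_cases h : Real.exp (-C) * ‖Ψ.ψ X‖ ≤ ‖Ψ.ψ (Matrix.vecCons y (Matrix.vecTail X))‖
    · exact Or.inl ⟨hy, h⟩
    · exact Or.inr ⟨hy, lt_of_not_ge h⟩
  have hsplit : ENNReal.ofReal L ^ 3 ≤
      (∫⁻ X in cellN (n + 1) L, Fg X) + ∫⁻ X in cellN (n + 1) L, Fb X :=
    calc ENNReal.ofReal L ^ 3 = 1 * ENNReal.ofReal L ^ 3 := (one_mul _).symm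
      _ = ∫⁻ X in cellN (n + 1) L, (‖Ψ.ψ X‖₊ : ℝ≥0∞) ^ 2 * ENNReal.ofReal L ^ 3 := by
          rw [lintegral_mul_const _ (hΨm.nnnorm.coe_nnreal_ennreal.pow_const 2), Ψ.norm_eq]
      _ ≤ ∫⁻ X in cellN (n + 1) L, (Fg X + Fb X) := lintegral_mono hpt
      _ = (∫⁻ X in cellN (n + 1) L, Fg X) + ∫⁻ X in cellN (n + 1) L, Fb X :=
          lintegral_add_left hFgm _
  -- hence the good mass is at least `L³ - L³/2 = L³/2`
  have h1 : ENNReal.ofReal L ^ 3 ≤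
      (∫⁻ X in cellN (n + 1) L, Fg X) + ENNReal.ofReal (L ^ 3 / 2) :=
    hsplit.trans (add_le_add_right hB _)
  have h2 : ENNReal.ofReal (L ^ 3 / 2) = ENNReal.ofReal L ^ 3 - ENNReal.ofReal (L ^ 3 / 2) := by
    rw [← ENNReal.ofReal_pow hL.le, ← ENNReal.ofReal_sub _ (by positivity)]
    congr 1
    ring
  rw [← hG, h2]
  exact tsub_le_iff_right.mpr h1

end LandscapeToCondensate

open LandscapeToCondensate in
/-- **`LandscapeToCondensate` (stmt-AtomisticToContinuum-8703), as stated in the route file.**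
For `L > 0`, `C ∈ ℝ` and a nonnegative periodic trial state `Ψ` of `n + 1` bosons on the torus of
side `L` whose exceptional mass `∫_{cell^n}∫_cell |Ψ(x,Y)|² vol{y ∈ cell : |Ψ(y,Y)| < e^{-C}|Ψ(x,Y)|}`
is `≤ L³/2`, the condensate occupation is `≥ (n+1) e^{-C}/2` (Penrose–Onsager one-sided step:
`occ₀ = (n+1)L⁻³∫ s², s² ≥ e^{-C}∫|Ψ|² vol(good)`, good mass `≥ L³/2`). [folklore] -/
theorem landscapeToCondensate_proof : LandscapeToCondensate := by
  intro n L C hL Ψ hΨ hbad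
  have hΨc : Continuous Ψ.ψ := Ψ.contDiff.continuous
  have hL3 : 0 < L ^ 3 := by positivity
  have he0 : 0 < Real.exp (-C) := Real.exp_pos _
  -- the good mass bound and the pointwise step give `e^{-C} L³/2 ≤ ∫ s²`
  have hI : ENNReal.ofReal (Real.exp (-C)) * ENNReal.ofReal (L ^ 3 / 2) ≤
      ∫⁻ Y in cellN n L, (‖∫ x in cell L, Ψ.ψ (Matrix.vecCons x Y)‖₊ : ℝ≥0∞) ^ 2 :=
    calc ENNReal.ofReal (Real.exp (-C)) * ENNReal.ofReal (L ^ 3 / 2)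
        ≤ ENNReal.ofReal (Real.exp (-C)) *
            ∫⁻ Y in cellN n L, ∫⁻ x in cell L, (‖Ψ.ψ (Matrix.vecCons x Y)‖₊ : ℝ≥0∞) ^ 2 *
              volume {y : Space | y ∈ cell L ∧
                Real.exp (-C) * ‖Ψ.ψ (Matrix.vecCons x Y)‖ ≤ ‖Ψ.ψ (Matrix.vecCons y Y)‖} :=
          mul_le_mul_right (half_volume_le_goodMass hL C Ψ hbad) _
      _ = ∫⁻ Y in cellN n L, ENNReal.ofReal (Real.exp (-C)) *
            ∫⁻ x in cell L, (‖Ψ.ψ (Matrix.vecCons x Y)‖₊ : ℝ≥0∞) ^ 2 *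
              volume {y : Space | y ∈ cell L ∧
                Real.exp (-C) * ‖Ψ.ψ (Matrix.vecCons x Y)‖ ≤ ‖Ψ.ψ (Matrix.vecCons y Y)‖} :=
          (lintegral_const_mul' _ _ ENNReal.ofReal_ne_top).symm
      _ ≤ ∫⁻ Y in cellN n L, (∫⁻ x in cell L, (‖Ψ.ψ (Matrix.vecCons x Y)‖₊ : ℝ≥0∞)) ^ 2 :=
          lintegral_mono fun Y => exp_mul_lintegral_sq_mul_good_le hΨc C Y
      _ = ∫⁻ Y in cellN n L, (‖∫ x in cell L, Ψ.ψ (Matrix.vecCons x Y)‖₊ : ℝ≥0∞) ^ 2 :=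
          lintegral_congr fun Y => by rw [enorm_setIntegral_slice hΨc hΨ Y]
  -- assemble with `occ₀ = (n+1) L⁻³ ∫ s²`
  rw [condensateOccupation_succ hL]
  have hcast : ENNReal.ofReal ((n + 1) * Real.exp (-C) / 2) =
      (n + 1 : ℝ≥0∞) * ((ENNReal.ofReal L ^ 3)⁻¹ *
        (ENNReal.ofReal (Real.exp (-C)) * ENNReal.ofReal (L ^ 3 / 2))) := by
    have hn : (n + 1 : ℝ≥0∞) = ENNReal.ofReal ((n : ℝ) + 1) := by
      rw [ENNReal.ofReal_add (Nat.cast_nonneg _) zero_le_one, ENNReal.ofReal_natCast,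
        ENNReal.ofReal_one]
    rw [hn, ← ENNReal.ofReal_pow hL.le, ← ENNReal.ofReal_inv_of_pos hL3,
      ← ENNReal.ofReal_mul he0.le, ← ENNReal.ofReal_mul (inv_nonneg.2 hL3.le),
      ← ENNReal.ofReal_mul (by positivity)]
    congr 1
    field_simp
  rw [hcast]
  exact mul_le_mul_right (mul_le_mul_right hI _) _

end Summit.AtomisticToContinuum.BoseEinsteinCondensation.Theorems

end
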